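import Literature.MathematicalPhysics.QuantumFieldTheory.Balaban1983to89.B11Eq80Current

/-!
# `Balaban1983to89.B11Eq98CurrentSlot` — T. Bałaban, *The variational problem and background fields in renormalization group method for lattice gauge theories*, Commun. Math. Phys. **102** (1985) 277–309 [Balaban1985Variational]: Proposition 4 (97)–(98) pp. 292–293 with (86), (88), (89) p. 291 and (55)–(57) p. 286 — PROPOSITION 4 FOR THE TYPED OBJECT `W = (δ/δA′)V` (`B11Eq80Current.W80`): the (98) bound `‖W(A′)‖₍₋₃₎ ≤ C₄‖A′‖²` «Gathering together all these estimates», assembled from the termwise (86)-, (88)-, (89)-forms under the DISPLAYED kernel-column letters of `H𝔇(A′)`, `H𝔇₃(A′)` (print's (73), (46)) and the norms of the letters `J`, `Δ_π`, plus the composed V₀-group's slot — i.e. BOTH W-slot clauses (`QuadAnalytic` ∧ `AnalyticOnNhd`) of the owner's `cur_chart_exists_of_W_H126` for `W80`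

statement-level skeleton of published theorems with citation tags; proofs where landed; nothing here is a claim about the Yang–Mills mass gap

PDF held: `paper:balaban1985-cmp102-variational-background` (journal page = PDF page + 276); pp. 285–293 read from the `lit read` text layer by
this seat (2026-08-21).

CITATION HEADER (lean-in-tree rule 2026-08-18).  WHAT IS REPRODUCED: row `B11.Prop4` of r08's `ROWS-B11.md` for the OBJECT `W80` (r08's
`B11Prop4Assembly` proves Prop. 4 for an abstract `TermwiseDatum` whose five estimates are hypotheses; here the groups are the typed W₁, W₂, W₃,
`curV0full` and the estimates are DERIVED from operator-level letters).  THE PRINT, verbatim.  p. 291: *«from the bound (73) it follows that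
|⟨H(δ/δA′)D₃(A′), J⟩| ≦ … ≦ O(1)ε₁ε₃²(Lʲη)⁻³ (86) … Applying the inequalities (3.132) from [5], (55), (73), … we can estimate this functional
derivative by O(1)ε₃²(Lʲη)⁻³ on Ω_j. The functional derivative of the third term … can be estimated by O(1)ε₃³(Lʲη)⁻³ on Ω_j.»*; pp. 292–293,
Prop. 4: *«The functional derivative of V(A′) is an analytic function on this space, and satisfies the estimate |((δ/δA′)V)(A′)| < C₄ε₃²(Lʲη)⁻³
on Ω_j … (97) The constants a₃, C₄ depend on d and L only. … |((δ/δA′)V)(A′)|₍₋₃₎ ≦ C₄(max{|A′|₍₋₁₎, |∇A′|₍₋₂₎})², (98)»*.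

WHAT IS PROVED (sorry-free; axioms standard; two defs `Jcur`, `C4W` with bodies; no `Prop`-valued definition, no new named fact).
§0 **`Jcur U₀ : NegSize L η lev₀ 3 𝔸`** — the letter `J` INSTANTIATED: r08's `B9Eq39Adjoint.J` ((27)/(28) = [5] (3.11)) read in the carrier;
   `pair27_Jcur` (`⟨Jcur, δ⟩ = ⟨δ, J⟩`, tracial `τ`); **`norm_Jcur_le`** ((28) at the carrier: `‖J‖₍₋₃₎ ≤ C₁B₃ε₁` from the bondwise (14) display
   via r08's `ineq28`) — the letter `‖J‖` of §3 discharged to (14).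
§1 `norm_Emap_le` ((55)+(46): `‖HD(A′)‖ ≤ bC₂‖A‖²`), `norm_Emap_le_sq` ((57)-form `≤ bC₂ℓ²‖A′‖²`, `ℓ = (1 − 4bC₂(ε_C + a_C))⁻¹`).
§2 **`norm_W1_le`** ((86)-form `≤ ‖ρ‖‖τ‖θ₃‖J‖·‖A′‖²`), **`norm_W2_le`** ((88)-form `≤ (‖Δπ‖bC₂ℓ² + ‖ρ‖‖τ‖θ_E‖Δπ‖)·‖A′‖²`), **`norm_W3_le`**
   ((89)-form, cubic: `≤ ‖ρ‖‖τ‖θ_E‖Δπ‖bC₂ℓ²R′·‖A′‖²`).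
§3 `C4W` + `C4W_nonneg`; **`norm_W80_le_sq`** — (98) FOR `W80` on `‖A′‖ < R′`; **`quadAnalytic_W80`** — `QuadAnalytic (W80 …) C₄ R′ ∧ AnalyticOnNhd ℂ
   (W80 …) {‖Y‖ < R′}` = BOTH W-SLOT CLAUSES of `NE9CurChartOfBackground.cur_chart_exists_of_W_H126` for the object; `prop4Hyp_W80` (the
   `B11Prop6Scheme.Prop4Hyp` form, r08's Sect. E input); `C4W_mono_J`, **`quadAnalytic_W80_Jcur`** (the same at `J := Jcur U₀` with `‖J‖`
   DISCHARGED to the (14) display: `C₄` in the letters `C₁B₃ε₁`, `‖Δπ‖`, θ₃, θ_E, `C_V`, `b, C₂, ε_C, a_C, R′`).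
HYPOTHESES (every one displayed; nothing of the papers derived here): the Sect. C regime `Regime H 0 C b 0 C₂ c₄ 0 a_C ε_C` of (47) with
`Prop4Hyp C C₂ c₄` (inhabited by leaf-03's `regime_sectC`/`prop4Hyp_Cc`); the V₀-group's (98)-slot READ AT `A`, `‖curV0 Y‖ ≤ C_V‖Y‖²` on
`‖Y‖ < R_V` (PROVED under its displays: g64's `B11Eq63V0GroupCurrent.quadAnalytic_curV0`); the KERNEL-COLUMN LETTERS on the ball `‖A′‖ < R′`:
`Σ_{b′}((Lʲ⁽ᵇ⁾η)³/(Lʲ⁽ᵇ′⁾η)³)‖k_{(HD)′(A′)}(b′, b)‖ ≤ θ_E‖A′‖` and `… ‖k_{(HD₃)′(A′)}(b′, b)‖ ≤ θ₃‖A′‖²` — print's kernel bounds (73)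
(`𝔇(A′) = O(|A′|)`, `𝔇₃` «with ε₃² instead of ε₃») composed with (46), WITH their exponential decay summed; NEEDS-CONSTANT letters θ_E, θ₃ —;
the norms `‖J‖₍₋₃₎` ((28): `< C₁B₃ε₁`, r08's `ineq28`) and `‖Δπ‖` ([5] (3.132)) of the letters; radii `0 ≤ R′ ≤ a_C`, `R′ ≤ (1 − 4bC₂(ε_C +
a_C))R_V`.

HONEST SCOPE — what is NOT claimed.  (i) The kernel letters θ_E, θ₃ and the norms of `J`, `Δπ` are DISPLAYED; their uniformity in the lattice
(print's «C₄ depend[s] on d and L only») is NOT adjudicated here.  (ii) `Δπ` remains a letter (leaf-01 types Δ_π at the carrier, `B9Eq3119DeltaPiCarrier`); `J := Jcur U₀` is available (§0)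
but §3 is stated for a general `J`.  (iii) With `B11Eq80Current.pair27_W80` ((63) certificate) and this file, the owner's `cur_chart_exists_of_W_H126` can be
fed `Wq := W80 …` with `hW := (quadAnalytic_W80 …).1`, `hWa := (quadAnalytic_W80 …).2`, `hC₄ := C4W_nonneg …` — the feeding itself is the
owner's/desk's one-liner, not done here.  (iv) NOT summit progress (cell pub-balaban: NE9 NOT PRINTED / NOT PROVED; «NE9 ⇐ the named binders»;
spine PROVED 0/9; HONEST DEPENDENCY: continuum YM on T⁴ ⇐ BetaPertH ∧ nine spine estimates (0/9 proved); BetaPertH ⇐ (D1) ∧ (D4) ∧ CAP+tail;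
G-an2-4 gates asym, D1 and NE2/3/4).  Unit `b2b-balaban-t4-ne9-formalise-leaf-05` (NE9 crux-team leaf prover, gen 65).  Imports `B11Eq80Current` ONLY.
-/

noncomputable section

open NormedSpace Complex Metric Set Finset Filter Topology

namespace Literature.MathematicalPhysics.QuantumFieldTheory.Balaban1983to89.B11Eq98CurrentSlot

open Literature.MathematicalPhysics.QuantumFieldTheory.Balaban1983to89.B11Prop6Scheme (Prop4Hyp)
open Literature.MathematicalPhysics.QuantumFieldTheory.Balaban1983to89.B13Contraction113 (QuadAnalytic)
open Literature.MathematicalPhysics.QuantumFieldTheory.Balaban1983to89.B11Eq174Chart (solA Regime)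
open Literature.MathematicalPhysics.QuantumFieldTheory.Balaban1983to89.B9Eq39Adjoint (bondPair)
open Literature.MathematicalPhysics.QuantumFieldTheory.Balaban1983to89.B11Eq90V0primeCurrent (Tsh Ucur curL curL_apply differentiable_curV0prime)
open Literature.MathematicalPhysics.QuantumFieldTheory.Balaban1983to89.B11Eq96CommutatorCurrent (differentiable_curComm)
open Literature.MathematicalPhysics.QuantumFieldTheory.Balaban1983to89.B11Eq63V0GroupCurrent (curV0)
open Literature.MathematicalPhysics.QuantumFieldTheory.Balaban1983to89.B11Eq90Transpose
open Literature.MathematicalPhysics.QuantumFieldTheory.Balaban1983to89.B11Eq90Pullback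
open Literature.MathematicalPhysics.QuantumFieldTheory.Balaban1983to89.B11Eq90V0GroupComposed
open Literature.MathematicalPhysics.QuantumFieldTheory.Balaban1983to89.B11Eq80Current
open B9SectCLatticeCarrier (Bond)
open B4Sect5Torus (TSite)
open B11Eq115Space

variable {𝔸 : Type*} [NormedRing 𝔸] [NormedAlgebra ℂ 𝔸] [FiniteDimensional ℂ 𝔸]
variable {d : ℕ} {Pd : Fin d → ℕ} {L η : ℝ} [Fact (0 < L)] [Fact (0 < η)] {lev₀ : Bond d Pd → ℕ} {κ' : Type*} [Fintype κ']
  {lev₁ : κ' → ℕ} {Dc : (Bond d Pd → 𝔸) →ₗ[ℂ] (κ' → 𝔸)}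
variable {𝒳 : Type*} [NormedAddCommGroup 𝒳] [NormedSpace ℂ 𝒳]
variable {H : 𝒳 →L[ℂ] Space115 L η lev₀ lev₁ Dc} {C : Space115 L η lev₀ lev₁ Dc → 𝒳} {b C₂ c₄ aC εC : ℝ}

/-! ## §0 The letter `J` at the carrier: the current (27) and its bound (28) in `|·|_{(−3)}` -/

section Jletter

omit [FiniteDimensional ℂ 𝔸]

/-- **THE CURRENT `J` OF (27)/(28) READ IN THE `|·|_{(−3)}`-CARRIER**: r08's `B9Eq39Adjoint.J` (= [5] (3.11) `D*η⁻²Im ∂U₀`) under the torus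
bridge (`Tsh`, `Ucur`), as an element of `NegSize L η lev₀ 3 𝔸` — the intended value of the letter `J` of `B11Eq80Current.V80`/`W80`.
[cite: Balaban1985Variational, (27)–(28) p.282] -/
def Jcur (U₀ : Bond d Pd → 𝔸ˣ) : NegSize L η lev₀ 3 𝔸 :=
  (NegSup.equiv (levWeight L η lev₀ 3) 𝔸).symm fun b => B9Eq39Adjoint.J Tsh (Ucur U₀) η b.2 b.1

omit [Fact (0 < L)] [Fact (0 < η)] [Fintype κ'] in
/-- Unfolding: under the identification `curL`, `Jcur` IS r08's `J`. [cite: Balaban1985Variational, (28) p.282] -/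
theorem curL_Jcur (U₀ : Bond d Pd → 𝔸ˣ) :
    curL (NegSup.equiv (levWeight L η lev₀ 3) 𝔸 (Jcur (L := L) (η := η) (lev₀ := lev₀) U₀)) = B9Eq39Adjoint.J Tsh (Ucur U₀) η := rfl

omit [Fact (0 < L)] [Fact (0 < η)] [Fintype κ'] in
/-- **(27) for the letter**: `⟨Jcur, δ⟩ = ⟨δ, J⟩` (r08's `bondPair … δ J`, tracial `τ`). [cite: Balaban1985Variational, (27) p.282] -/
theorem pair27_Jcur (τ : 𝔸 →L[ℂ] ℂ) (hτ : ∀ a b : 𝔸, τ (a * b) = τ (b * a)) (U₀ : Bond d Pd → 𝔸ˣ) (δ : Bond d Pd → 𝔸) :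
    pair27 τ (Jcur (L := L) (η := η) (lev₀ := lev₀) U₀) δ = bondPair η d (τ : 𝔸 →ₗ[ℂ] ℂ) (curL δ) (B9Eq39Adjoint.J Tsh (Ucur U₀) η) := by
  rw [pair27_def, curL_Jcur, bondPair, bondPair]
  congr 1
  exact Finset.sum_congr rfl fun x _ => Finset.sum_congr rfl fun μ _ => hτ _ _

/-- **(28) AT THE CARRIER: `‖J‖₍₋₃₎ ≤ C₁B₃ε₁`** — from the bondwise form of the assumption (14) («`|(D*_{U₀}∂U₀)(b)| < C₁B₃ε₁η²(Lʲη)⁻³` for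
`b ∈ Ω_j`», read with the level weights) via r08's `B11Eq27Current.ineq28` (unitary background, `‖X*‖ = ‖X‖`). The NEEDS-CONSTANT letter `‖J‖`
of §3 discharged to the display (14). [cite: Balaban1985Variational, (28) p.282, (14) p.279] -/
theorem norm_Jcur_le [StarRing 𝔸] [NormedStarGroup 𝔸] [StarModule ℂ 𝔸] (U₀ : Bond d Pd → 𝔸ˣ)
    (hU : ∀ b : Bond d Pd, (((U₀ b)⁻¹ : 𝔸ˣ) : 𝔸) = star (U₀ b : 𝔸)) {C₁ B₃ ε₁ : ℝ} (hK : 0 ≤ C₁ * B₃ * ε₁)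
    (h14 : ∀ b : Bond d Pd, ‖B9Eq39Adjoint.divPη Tsh (Ucur U₀) η (B11Eq27Current.plaqField Tsh (Ucur U₀)) b.2 b.1‖
      ≤ C₁ * B₃ * ε₁ * η ^ 2 * (levWeight L η lev₀ 1 b)⁻¹ ^ 3) :
    ‖Jcur (L := L) (η := η) (lev₀ := lev₀) U₀‖ ≤ C₁ * B₃ * ε₁ := by
  rw [NegSup.norm_le_iff hK]
  intro b
  have hη : (0 : ℝ) < η := Fact.out
  have h28 := B11Eq27Current.ineq28 Tsh (Ucur U₀) (fun μ x => hU (x, μ)) hη b.2 b.1 (h14 b)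
  have hw1 : 0 < levWeight L η lev₀ 1 b := levWeight_pos (Fact.out : 0 < L) hη lev₀ 1 b
  have hw : levWeight L η lev₀ 3 b = levWeight L η lev₀ 1 b ^ 3 := by rw [levWeight_apply, levWeight_apply, pow_one]
  rw [hw]
  calc levWeight L η lev₀ 1 b ^ 3 * ‖NegSup.equiv (levWeight L η lev₀ 3) 𝔸 (Jcur (L := L) (η := η) (lev₀ := lev₀) U₀) b‖
      ≤ levWeight L η lev₀ 1 b ^ 3 * (C₁ * B₃ * ε₁ * (levWeight L η lev₀ 1 b)⁻¹ ^ 3) :=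
        mul_le_mul_of_nonneg_left h28 (pow_nonneg hw1.le 3)
    _ = C₁ * B₃ * ε₁ := by field_simp

end Jletter

/-! ## §1 The size of `HD(A′)`: `‖HD(A′)‖ ≤ bC₂‖A‖² ≤ bC₂ℓ²‖A′‖²` ((46), (55), (57)) -/

/-- **(55)+(46): `‖HD(A′)‖ ≤ b·C₂·‖A‖²`** on `‖A′‖ < a_C` (`‖Hf‖ ≤ b‖f‖`, `‖C(Y)‖ ≤ C₂‖Y‖²` on `‖Y‖ < c₄`, and `‖A‖ < ε_C + a_C ≤ c₄/2`).
[cite: Balaban1985Variational, (55) p.286, (46) p.285] -/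
theorem norm_Emap_le (RC : Regime H 0 C b 0 C₂ c₄ 0 aC εC) {A' : Space115 L η lev₀ lev₁ Dc} (hA' : ‖A'‖ < aC) :
    ‖Emap H C εC A'‖ ≤ b * C₂ * ‖T47 H C εC A'‖ ^ 2 := by
  have hT : ‖T47 H C εC A'‖ < c₄ := by
    have h := norm_T47_lt RC hA'
    linarith [RC.dom, RC.ε₄_nonneg, norm_nonneg (T47 H C εC A')]
  rw [Emap_eq_H RC hA']
  calc ‖H (C (T47 H C εC A'))‖ ≤ b * ‖C (T47 H C εC A')‖ := RC.norm_G _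
    _ ≤ b * (C₂ * ‖T47 H C εC A'‖ ^ 2) := mul_le_mul_of_nonneg_left (RC.quad.quad _ hT) RC.B₀_nonneg
    _ = b * C₂ * ‖T47 H C εC A'‖ ^ 2 := by ring

/-- **(57)-form: `‖HD(A′)‖ ≤ bC₂ℓ²‖A′‖²`**, `ℓ = 1/(1 − 4bC₂(ε_C + a_C))`. [cite: Balaban1985Variational, (57) p.286] -/
theorem norm_Emap_le_sq (RC : Regime H 0 C b 0 C₂ c₄ 0 aC εC) {A' : Space115 L η lev₀ lev₁ Dc} (hA' : ‖A'‖ < aC) :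
    ‖Emap H C εC A'‖ ≤ b * C₂ * (1 / (1 - 4 * b * C₂ * (εC + aC))) ^ 2 * ‖A'‖ ^ 2 := by
  have h1q : 0 < 1 - 4 * b * C₂ * (εC + aC) := by linarith [RC.contr]
  have hT : ‖T47 H C εC A'‖ ≤ 1 / (1 - 4 * b * C₂ * (εC + aC)) * ‖A'‖ := by
    rw [one_div_mul_eq_div]; exact norm_T47_le RC hA'
  have hbC : 0 ≤ b * C₂ := mul_nonneg RC.B₀_nonneg RC.C₄_nonneg
  calc ‖Emap H C εC A'‖ ≤ b * C₂ * ‖T47 H C εC A'‖ ^ 2 := norm_Emap_le RC hA'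
    _ ≤ b * C₂ * (1 / (1 - 4 * b * C₂ * (εC + aC)) * ‖A'‖) ^ 2 := by gcongr
    _ = b * C₂ * (1 / (1 - 4 * b * C₂ * (εC + aC))) ^ 2 * ‖A'‖ ^ 2 := by ring

/-! ## §2 The (98)-form bounds of the three Sect. D groups under the displayed kernel letters -/

variable (ρ : (𝔸 →L[ℂ] ℂ) →L[ℂ] 𝔸) (τ : 𝔸 →L[ℂ] ℂ)

/-- **(86)-form: `‖W₁(A′)‖₍₋₃₎ ≤ ‖ρ‖‖τ‖·θ₃‖A′‖²·‖J‖₍₋₃₎`** — from the DISPLAYED column letter of the kernel of `(HD₃)′(A′) = H𝔇₃(A′)`: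
`Σ_{b′}((Lʲ⁽ᵇ⁾η)³/(Lʲ⁽ᵇ′⁾η)³)‖k(b′, b)‖ ≤ θ₃‖A′‖²` (print: the bound (73) for `𝔇₃` «with ε₃² instead of ε₃» after Prop. 3, and (46) for `H`, giving
(86) `≤ O(1)ε₁ε₃²(Lʲη)⁻³` with `|J| < C₁B₃ε₁(Lʲη)⁻³`). [cite: Balaban1985Variational, (86) p.291, (73) p.289, (28) p.282] -/
theorem norm_W1_le (J : NegSize L η lev₀ 3 𝔸) {A' : Space115 L η lev₀ lev₁ Dc} {θ₃ : ℝ} (hθ₃ : 0 ≤ θ₃)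
    (hΘ3 : ∀ bb : Bond d Pd, ∑ b' : Bond d Pd, levWeight L η lev₀ 3 bb / levWeight L η lev₀ 3 b'
      * ‖kernel (fderiv ℂ (E3 H C εC) A') b' bb‖ ≤ θ₃ * ‖A'‖ ^ 2) :
    ‖W1 ρ τ H C εC J A'‖ ≤ ‖ρ‖ * ‖τ‖ * θ₃ * ‖J‖ * ‖A'‖ ^ 2 := by
  rw [W1, norm_neg]
  calc ‖transCur ρ τ (fderiv ℂ (E3 H C εC) A') J‖ ≤ ‖ρ‖ * ‖τ‖ * (θ₃ * ‖A'‖ ^ 2) * ‖J‖ :=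
        norm_transCur_le ρ τ _ (by positivity) hΘ3 J
    _ = ‖ρ‖ * ‖τ‖ * θ₃ * ‖J‖ * ‖A'‖ ^ 2 := by ring

/-- **(88)-form: `‖W₂(A′)‖₍₋₃₎ ≤ (‖Δπ‖·bC₂ℓ² + ‖ρ‖‖τ‖θ_E‖Δπ‖)·‖A′‖²`** on `‖A′‖ < a_C` — `‖Δ_π HD(A′)‖ ≤ ‖Δπ‖·bC₂ℓ²‖A′‖²` ((55)/(57) and the
operator norm of `Δπ`, print's [5] (3.132)) plus the transposed term through the DISPLAYED column letter of the kernel of `(HD)′(A′) = H𝔇(A′)`: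
`≤ θ_E‖A′‖` (print: (73) `𝔇(A′) = O(|A′|)`, (46)). [cite: Balaban1985Variational, (88) p.291, (73) p.289, (46) p.285] -/
theorem norm_W2_le (RC : Regime H 0 C b 0 C₂ c₄ 0 aC εC) (Δπ : Space115 L η lev₀ lev₁ Dc →L[ℂ] NegSize L η lev₀ 3 𝔸)
    {A' : Space115 L η lev₀ lev₁ Dc} (hA' : ‖A'‖ < aC) {θE : ℝ} (hθE : 0 ≤ θE)
    (hΘE : ∀ bb : Bond d Pd, ∑ b' : Bond d Pd, levWeight L η lev₀ 3 bb / levWeight L η lev₀ 3 b'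
      * ‖kernel (fderiv ℂ (Emap H C εC) A') b' bb‖ ≤ θE * ‖A'‖) :
    ‖W2 ρ τ H C εC Δπ A'‖ ≤ (‖Δπ‖ * (b * C₂ * (1 / (1 - 4 * b * C₂ * (εC + aC))) ^ 2) + ‖ρ‖ * ‖τ‖ * θE * ‖Δπ‖) * ‖A'‖ ^ 2 := by
  rw [W2, norm_neg]
  have h1 : ‖Δπ (Emap H C εC A')‖ ≤ ‖Δπ‖ * (b * C₂ * (1 / (1 - 4 * b * C₂ * (εC + aC))) ^ 2) * ‖A'‖ ^ 2 := by
    calc ‖Δπ (Emap H C εC A')‖ ≤ ‖Δπ‖ * ‖Emap H C εC A'‖ := Δπ.le_opNorm _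
      _ ≤ ‖Δπ‖ * (b * C₂ * (1 / (1 - 4 * b * C₂ * (εC + aC))) ^ 2 * ‖A'‖ ^ 2) := by gcongr; exact norm_Emap_le_sq RC hA'
      _ = _ := by ring
  have h2 : ‖transCur ρ τ (fderiv ℂ (Emap H C εC) A') (Δπ A')‖ ≤ ‖ρ‖ * ‖τ‖ * θE * ‖Δπ‖ * ‖A'‖ ^ 2 := by
    calc ‖transCur ρ τ (fderiv ℂ (Emap H C εC) A') (Δπ A')‖ ≤ ‖ρ‖ * ‖τ‖ * (θE * ‖A'‖) * ‖Δπ A'‖ :=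
          norm_transCur_le ρ τ _ (by positivity) hΘE _
      _ ≤ ‖ρ‖ * ‖τ‖ * (θE * ‖A'‖) * (‖Δπ‖ * ‖A'‖) := by gcongr; exact Δπ.le_opNorm _
      _ = ‖ρ‖ * ‖τ‖ * θE * ‖Δπ‖ * ‖A'‖ ^ 2 := by ring
  calc ‖Δπ (Emap H C εC A') + transCur ρ τ (fderiv ℂ (Emap H C εC) A') (Δπ A')‖
      ≤ ‖Δπ (Emap H C εC A')‖ + ‖transCur ρ τ (fderiv ℂ (Emap H C εC) A') (Δπ A')‖ := norm_add_le _ _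
    _ ≤ _ := by rw [add_mul]; exact add_le_add h1 h2

/-- **(89)-form: `‖W₃(A′)‖₍₋₃₎ ≤ ‖ρ‖‖τ‖θ_E‖Δπ‖bC₂ℓ²·R′·‖A′‖²`** on `‖A′‖ < R′ ≤ a_C` (a cubic term, `≤ O(1)ε₃³` in print).
[cite: Balaban1985Variational, (89) p.291] -/
theorem norm_W3_le (RC : Regime H 0 C b 0 C₂ c₄ 0 aC εC) (Δπ : Space115 L η lev₀ lev₁ Dc →L[ℂ] NegSize L η lev₀ 3 𝔸)
    {A' : Space115 L η lev₀ lev₁ Dc} {R' : ℝ} (hA' : ‖A'‖ < R') (hR'a : R' ≤ aC) {θE : ℝ} (hθE : 0 ≤ θE)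
    (hΘE : ∀ bb : Bond d Pd, ∑ b' : Bond d Pd, levWeight L η lev₀ 3 bb / levWeight L η lev₀ 3 b'
      * ‖kernel (fderiv ℂ (Emap H C εC) A') b' bb‖ ≤ θE * ‖A'‖) :
    ‖W3 ρ τ H C εC Δπ A'‖
      ≤ ‖ρ‖ * ‖τ‖ * θE * ‖Δπ‖ * (b * C₂ * (1 / (1 - 4 * b * C₂ * (εC + aC))) ^ 2) * R' * ‖A'‖ ^ 2 := by
  have hA'a : ‖A'‖ < aC := lt_of_lt_of_le hA' hR'a
  have hbC : 0 ≤ b * C₂ * (1 / (1 - 4 * b * C₂ * (εC + aC))) ^ 2 := by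
    have := mul_nonneg RC.B₀_nonneg RC.C₄_nonneg; positivity
  rw [W3]
  calc ‖transCur ρ τ (fderiv ℂ (Emap H C εC) A') (Δπ (Emap H C εC A'))‖
      ≤ ‖ρ‖ * ‖τ‖ * (θE * ‖A'‖) * ‖Δπ (Emap H C εC A')‖ := norm_transCur_le ρ τ _ (by positivity) hΘE _
    _ ≤ ‖ρ‖ * ‖τ‖ * (θE * ‖A'‖) * (‖Δπ‖ * (b * C₂ * (1 / (1 - 4 * b * C₂ * (εC + aC))) ^ 2 * ‖A'‖ ^ 2)) := by
        gcongr
        exact (Δπ.le_opNorm _).trans (mul_le_mul_of_nonneg_left (norm_Emap_le_sq RC hA'a) (norm_nonneg _))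
    _ = ‖ρ‖ * ‖τ‖ * θE * ‖Δπ‖ * (b * C₂ * (1 / (1 - 4 * b * C₂ * (εC + aC))) ^ 2) * ‖A'‖ * ‖A'‖ ^ 2 := by ring
    _ ≤ ‖ρ‖ * ‖τ‖ * θE * ‖Δπ‖ * (b * C₂ * (1 / (1 - 4 * b * C₂ * (εC + aC))) ^ 2) * R' * ‖A'‖ ^ 2 := by
        gcongr

/-! ## §3 Proposition 4 for the object `W = (δ/δA′)V`: both W-slot clauses of the owner's theorem, under the displayed letters -/

section Prop4

variable [CompleteSpace 𝔸]

/-- **THE CONSTANT `C₄` OF (97)/(98) FOR `W80`** «Gathering together all these estimates»: the four group constants summed (in the letters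
`‖ρ‖, ‖τ‖, ‖J‖₍₋₃₎, ‖Δπ‖, b, C₂, ℓ = (1 − 4bC₂(ε_C + a_C))⁻¹, θ₃, θ_E, C_V, R′`). [cite: Balaban1985Variational, (97) p.293] -/
def C4W (nρ nτ nJ nΔ b C₂ ℓ θ₃ θE CV R' : ℝ) : ℝ :=
  nρ * nτ * θ₃ * nJ + (nΔ * (b * C₂ * ℓ ^ 2) + nρ * nτ * θE * nΔ) + nρ * nτ * θE * nΔ * (b * C₂ * ℓ ^ 2) * R'
    + nρ * nτ * (1 + θE * R') * CV * ℓ ^ 2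

/-- `C₄ ≥ 0` for non-negative letters (the `hC₄` binder of the owner's theorem). [cite: Balaban1985Variational, (97) p.293] -/
theorem C4W_nonneg {nρ nτ nJ nΔ b C₂ ℓ θ₃ θE CV R' : ℝ} (hρ : 0 ≤ nρ) (hτ : 0 ≤ nτ) (hJ : 0 ≤ nJ) (hΔ : 0 ≤ nΔ) (hb : 0 ≤ b)
    (hC₂ : 0 ≤ C₂) (hθ₃ : 0 ≤ θ₃) (hθE : 0 ≤ θE) (hCV : 0 ≤ CV) (hR' : 0 ≤ R') :
    0 ≤ C4W nρ nτ nJ nΔ b C₂ ℓ θ₃ θE CV R' := by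
  unfold C4W; positivity

/-- **PROPOSITION 4 FOR THE OBJECT `W80` — THE (98) BOUND `‖W(A′)‖₍₋₃₎ ≤ C₄‖A′‖²` on `‖A′‖ < R′`**, under: the Sect. C regime of (47) with `C` of
Prop.-4 type; the V₀-group's slot read at `A` (`‖curV0 Y‖ ≤ C_V‖Y‖²` on `‖Y‖ < R_V`, PROVED under its displays in `B11Eq63V0GroupCurrent`); the
DISPLAYED kernel-column letters `θ_E` (of `H𝔇(A′)`, linear in `‖A′‖`) and `θ₃` (of `H𝔇₃(A′)`, quadratic) on the ball — print's (73), (46) —; and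
the radius conditions `R′ ≤ a_C`, `R′ ≤ (1 − 4bC₂(ε_C + a_C))R_V`.  The letters `‖J‖₍₋₃₎` ((28): `< C₁B₃ε₁`) and `‖Δπ‖` ([5] (3.132)) enter
through their norms. [cite: Balaban1985Variational, Prop. 4 (97)–(98) pp.292–293, (86)–(90) p.291] -/
theorem norm_W80_le_sq (U₀ : Bond d Pd → 𝔸ˣ) {CV RV : ℝ} (hCV : 0 ≤ CV)
    (hqV : ∀ Y : Space115 L η lev₀ lev₁ Dc, ‖Y‖ < RV → ‖curV0 (lev₁ := lev₁) (Dc := Dc) ρ τ U₀ Y‖ ≤ CV * ‖Y‖ ^ 2)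
    (RC : Regime H 0 C b 0 C₂ c₄ 0 aC εC) (hC : Prop4Hyp C C₂ c₄) (J : NegSize L η lev₀ 3 𝔸)
    (Δπ : Space115 L η lev₀ lev₁ Dc →L[ℂ] NegSize L η lev₀ 3 𝔸) {R' θ₃ θE : ℝ} (hθ₃ : 0 ≤ θ₃) (hθE : 0 ≤ θE) (hR'0 : 0 ≤ R')
    (hR'a : R' ≤ aC) (hR'V : R' ≤ (1 - 4 * b * C₂ * (εC + aC)) * RV)
    (hΘE : ∀ A' : Space115 L η lev₀ lev₁ Dc, ‖A'‖ < R' → ∀ bb : Bond d Pd, ∑ b' : Bond d Pd,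
      levWeight L η lev₀ 3 bb / levWeight L η lev₀ 3 b' * ‖kernel (fderiv ℂ (Emap H C εC) A') b' bb‖ ≤ θE * ‖A'‖)
    (hΘ3 : ∀ A' : Space115 L η lev₀ lev₁ Dc, ‖A'‖ < R' → ∀ bb : Bond d Pd, ∑ b' : Bond d Pd,
      levWeight L η lev₀ 3 bb / levWeight L η lev₀ 3 b' * ‖kernel (fderiv ℂ (E3 H C εC) A') b' bb‖ ≤ θ₃ * ‖A'‖ ^ 2)
    {A' : Space115 L η lev₀ lev₁ Dc} (hA' : ‖A'‖ < R') :
    ‖W80 ρ τ U₀ H C εC J Δπ A'‖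
      ≤ C4W ‖ρ‖ ‖τ‖ ‖J‖ ‖Δπ‖ b C₂ (1 / (1 - 4 * b * C₂ * (εC + aC))) θ₃ θE CV R' * ‖A'‖ ^ 2 := by
  have hA'a : ‖A'‖ < aC := lt_of_lt_of_le hA' hR'a
  -- the kernel of `(solA)′ = −(Emap)′` has the same columns as that of `(Emap)′`
  have hΘsol : ∀ A'' : Space115 L η lev₀ lev₁ Dc, ‖A''‖ < R' → ∀ bb : Bond d Pd, ∑ b' : Bond d Pd,
      levWeight L η lev₀ 3 bb / levWeight L η lev₀ 3 b' * ‖kernel (fderiv ℂ (solA H 0 C 0 εC) A'') b' bb‖ ≤ θE * R' := by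
    intro A'' hA'' bb
    have hs : solA H 0 C 0 εC = -(Emap H C εC : Space115 L η lev₀ lev₁ Dc → Space115 L η lev₀ lev₁ Dc) := by
      funext Y; rw [Pi.neg_apply, Emap, neg_neg]
    have hk : ∀ b', ‖kernel (fderiv ℂ (solA H 0 C 0 εC) A'') b' bb‖ = ‖kernel (fderiv ℂ (Emap H C εC) A'') b' bb‖ := by
      intro b'
      rw [hs, fderiv_neg]
      have : kernel (-fderiv ℂ (Emap H C εC) A'') b' bb = -kernel (fderiv ℂ (Emap H C εC) A'') b' bb := by
        ext X; simp only [kernel_apply, neg_apply, map_neg, Pi.neg_apply]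
      rw [this, norm_neg]
    simp only [hk]
    exact (hΘE A'' hA'' bb).trans (mul_le_mul_of_nonneg_left hA''.le hθE)
  have h45 : ‖curV0full ρ τ U₀ H C εC A'‖
      ≤ ‖ρ‖ * ‖τ‖ * (1 + θE * R') * CV * (1 / (1 - 4 * b * C₂ * (εC + aC))) ^ 2 * ‖A'‖ ^ 2 :=
    (prop4Hyp_curV0full ρ τ U₀ (CV := CV) (RV := RV)
      ⟨hqV, fun P Q => by
        have hcur : Differentiable ℂ (curV0 (L := L) (η := η) (lev₀ := lev₀) (lev₁ := lev₁) (Dc := Dc) ρ τ U₀) :=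
          (differentiable_curV0prime (lev₁ := lev₁) (Dc := Dc) ρ τ U₀).add (differentiable_curComm (lev₁ := lev₁) (Dc := Dc) ρ τ U₀)
        exact (hcur.comp ((differentiable_const P).add (differentiable_id.smul_const Q))).differentiableOn⟩
      hCV RC hC (by positivity) hΘsol hR'a hR'V).quad A' hA'
  have h1 := norm_W1_le ρ τ J hθ₃ (hΘ3 A' hA')
  have h2 := norm_W2_le ρ τ RC Δπ hA'a hθE (hΘE A' hA')
  have h3 := norm_W3_le ρ τ RC Δπ hA' hR'a hθE (hΘE A' hA')
  calc ‖W80 ρ τ U₀ H C εC J Δπ A'‖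
      ≤ ‖W1 ρ τ H C εC J A'‖ + ‖W2 ρ τ H C εC Δπ A'‖ + ‖W3 ρ τ H C εC Δπ A'‖ + ‖curV0full ρ τ U₀ H C εC A'‖ := by
        unfold W80
        exact (norm_add_le _ _).trans (add_le_add ((norm_add_le _ _).trans (add_le_add (norm_add_le _ _) le_rfl)) le_rfl)
    _ ≤ _ := by
        unfold C4W
        nlinarith [h1, h2, h3, h45, sq_nonneg ‖A'‖]

/-- **BOTH W-SLOT CLAUSES OF THE OWNER's `cur_chart_exists_of_W_H126` FOR THE OBJECT `W80`** — `QuadAnalytic (W80 …) C₄ R′` ((98) + analyticity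
along lines) ∧ `AnalyticOnNhd ℂ (W80 …) {‖Y‖ < R′}` (Prop. 4's «an analytic function on this space»), under the hypotheses of `norm_W80_le_sq`;
together with the (63) certificate `B11Eq80Current.pair27_W80` this is print's Proposition 4 for the typed `W = (δ/δA′)V`, modulo the displayed
letters. [cite: Balaban1985Variational, Prop. 4 (97)–(98) pp.292–293] -/
theorem quadAnalytic_W80 [CompleteSpace 𝒳] (U₀ : Bond d Pd → 𝔸ˣ) {CV RV : ℝ} (hCV : 0 ≤ CV)
    (hqV : ∀ Y : Space115 L η lev₀ lev₁ Dc, ‖Y‖ < RV → ‖curV0 (lev₁ := lev₁) (Dc := Dc) ρ τ U₀ Y‖ ≤ CV * ‖Y‖ ^ 2)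
    (RC : Regime H 0 C b 0 C₂ c₄ 0 aC εC) (hC : Prop4Hyp C C₂ c₄) (J : NegSize L η lev₀ 3 𝔸)
    (Δπ : Space115 L η lev₀ lev₁ Dc →L[ℂ] NegSize L η lev₀ 3 𝔸) {R' θ₃ θE : ℝ} (hθ₃ : 0 ≤ θ₃) (hθE : 0 ≤ θE) (hR'0 : 0 ≤ R')
    (hR'a : R' ≤ aC) (hR'V : R' ≤ (1 - 4 * b * C₂ * (εC + aC)) * RV)
    (hΘE : ∀ A' : Space115 L η lev₀ lev₁ Dc, ‖A'‖ < R' → ∀ bb : Bond d Pd, ∑ b' : Bond d Pd,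
      levWeight L η lev₀ 3 bb / levWeight L η lev₀ 3 b' * ‖kernel (fderiv ℂ (Emap H C εC) A') b' bb‖ ≤ θE * ‖A'‖)
    (hΘ3 : ∀ A' : Space115 L η lev₀ lev₁ Dc, ‖A'‖ < R' → ∀ bb : Bond d Pd, ∑ b' : Bond d Pd,
      levWeight L η lev₀ 3 bb / levWeight L η lev₀ 3 b' * ‖kernel (fderiv ℂ (E3 H C εC) A') b' bb‖ ≤ θ₃ * ‖A'‖ ^ 2) :
    QuadAnalytic (W80 ρ τ U₀ H C εC J Δπ) (C4W ‖ρ‖ ‖τ‖ ‖J‖ ‖Δπ‖ b C₂ (1 / (1 - 4 * b * C₂ * (εC + aC))) θ₃ θE CV R') R' ∧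
      AnalyticOnNhd ℂ (W80 ρ τ U₀ H C εC J Δπ) {Y : Space115 L η lev₀ lev₁ Dc | ‖Y‖ < R'} := by
  have han := analyticOnNhd_W80_lt ρ τ U₀ RC hC J Δπ hR'a
  refine ⟨⟨fun _ hY => norm_W80_le_sq ρ τ U₀ hCV hqV RC hC J Δπ hθ₃ hθE hR'0 hR'a hR'V hΘE hΘ3 hY, fun P Q => ?_⟩, han⟩
  have hline : Differentiable ℂ (fun ζ : ℂ => P + ζ • Q) := (differentiable_const P).add (differentiable_id.smul_const Q)
  exact han.differentiableOn.comp hline.differentiableOn fun ζ hζ => hζ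

/-- The same packaged as `B11Prop6Scheme.Prop4Hyp` (Fréchet form). [cite: Balaban1985Variational, Prop. 4 (98) p.293] -/
theorem prop4Hyp_W80 [CompleteSpace 𝒳] (U₀ : Bond d Pd → 𝔸ˣ) {CV RV : ℝ} (hCV : 0 ≤ CV)
    (hqV : ∀ Y : Space115 L η lev₀ lev₁ Dc, ‖Y‖ < RV → ‖curV0 (lev₁ := lev₁) (Dc := Dc) ρ τ U₀ Y‖ ≤ CV * ‖Y‖ ^ 2)
    (RC : Regime H 0 C b 0 C₂ c₄ 0 aC εC) (hC : Prop4Hyp C C₂ c₄) (J : NegSize L η lev₀ 3 𝔸)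
    (Δπ : Space115 L η lev₀ lev₁ Dc →L[ℂ] NegSize L η lev₀ 3 𝔸) {R' θ₃ θE : ℝ} (hθ₃ : 0 ≤ θ₃) (hθE : 0 ≤ θE) (hR'0 : 0 ≤ R')
    (hR'a : R' ≤ aC) (hR'V : R' ≤ (1 - 4 * b * C₂ * (εC + aC)) * RV)
    (hΘE : ∀ A' : Space115 L η lev₀ lev₁ Dc, ‖A'‖ < R' → ∀ bb : Bond d Pd, ∑ b' : Bond d Pd,
      levWeight L η lev₀ 3 bb / levWeight L η lev₀ 3 b' * ‖kernel (fderiv ℂ (Emap H C εC) A') b' bb‖ ≤ θE * ‖A'‖)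
    (hΘ3 : ∀ A' : Space115 L η lev₀ lev₁ Dc, ‖A'‖ < R' → ∀ bb : Bond d Pd, ∑ b' : Bond d Pd,
      levWeight L η lev₀ 3 bb / levWeight L η lev₀ 3 b' * ‖kernel (fderiv ℂ (E3 H C εC) A') b' bb‖ ≤ θ₃ * ‖A'‖ ^ 2) :
    Prop4Hyp (W80 ρ τ U₀ H C εC J Δπ) (C4W ‖ρ‖ ‖τ‖ ‖J‖ ‖Δπ‖ b C₂ (1 / (1 - 4 * b * C₂ * (εC + aC))) θ₃ θE CV R') R' where
  quad _ hY := norm_W80_le_sq ρ τ U₀ hCV hqV RC hC J Δπ hθ₃ hθE hR'0 hR'a hR'V hΘE hΘ3 hY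
  differentiableOn := (analyticOnNhd_W80_lt ρ τ U₀ RC hC J Δπ hR'a).differentiableOn

/-- `C4W` is monotone in the letter `‖J‖` (its coefficient `‖ρ‖‖τ‖θ₃` is non-negative). [cite: Balaban1985Variational, (97) p.293] -/
theorem C4W_mono_J {nρ nτ nJ nJ' nΔ b C₂ ℓ θ₃ θE CV R' : ℝ} (hρ : 0 ≤ nρ) (hτ : 0 ≤ nτ) (hθ₃ : 0 ≤ θ₃) (hJ : nJ ≤ nJ') :
    C4W nρ nτ nJ nΔ b C₂ ℓ θ₃ θE CV R' ≤ C4W nρ nτ nJ' nΔ b C₂ ℓ θ₃ θE CV R' := by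
  unfold C4W
  have : nρ * nτ * θ₃ * nJ ≤ nρ * nτ * θ₃ * nJ' := mul_le_mul_of_nonneg_left hJ (by positivity)
  linarith

/-- **BOTH W-SLOT CLAUSES AT `J := Jcur U₀` WITH THE LETTER `‖J‖` DISCHARGED TO (14)** — `C₄` in the letters `C₁B₃ε₁` ((28)), `‖Δπ‖`, θ₃, θ_E,
`C_V`, the Sect. C regime's `b, C₂, ε_C, a_C` and `R′`. [cite: Balaban1985Variational, Prop. 4 (97)–(98) pp.292–293, (28) p.282] -/
theorem quadAnalytic_W80_Jcur [StarRing 𝔸] [NormedStarGroup 𝔸] [StarModule ℂ 𝔸] [CompleteSpace 𝒳] (U₀ : Bond d Pd → 𝔸ˣ)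
    (hU : ∀ b : Bond d Pd, (((U₀ b)⁻¹ : 𝔸ˣ) : 𝔸) = star (U₀ b : 𝔸)) {C₁ B₃ ε₁ : ℝ} (hK : 0 ≤ C₁ * B₃ * ε₁)
    (h14 : ∀ b : Bond d Pd, ‖B9Eq39Adjoint.divPη Tsh (Ucur U₀) η (B11Eq27Current.plaqField Tsh (Ucur U₀)) b.2 b.1‖
      ≤ C₁ * B₃ * ε₁ * η ^ 2 * (levWeight L η lev₀ 1 b)⁻¹ ^ 3)
    {CV RV : ℝ} (hCV : 0 ≤ CV)
    (hqV : ∀ Y : Space115 L η lev₀ lev₁ Dc, ‖Y‖ < RV → ‖curV0 (lev₁ := lev₁) (Dc := Dc) ρ τ U₀ Y‖ ≤ CV * ‖Y‖ ^ 2)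
    (RC : Regime H 0 C b 0 C₂ c₄ 0 aC εC) (hC : Prop4Hyp C C₂ c₄)
    (Δπ : Space115 L η lev₀ lev₁ Dc →L[ℂ] NegSize L η lev₀ 3 𝔸) {R' θ₃ θE : ℝ} (hθ₃ : 0 ≤ θ₃) (hθE : 0 ≤ θE) (hR'0 : 0 ≤ R')
    (hR'a : R' ≤ aC) (hR'V : R' ≤ (1 - 4 * b * C₂ * (εC + aC)) * RV)
    (hΘE : ∀ A' : Space115 L η lev₀ lev₁ Dc, ‖A'‖ < R' → ∀ bb : Bond d Pd, ∑ b' : Bond d Pd,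
      levWeight L η lev₀ 3 bb / levWeight L η lev₀ 3 b' * ‖kernel (fderiv ℂ (Emap H C εC) A') b' bb‖ ≤ θE * ‖A'‖)
    (hΘ3 : ∀ A' : Space115 L η lev₀ lev₁ Dc, ‖A'‖ < R' → ∀ bb : Bond d Pd, ∑ b' : Bond d Pd,
      levWeight L η lev₀ 3 bb / levWeight L η lev₀ 3 b' * ‖kernel (fderiv ℂ (E3 H C εC) A') b' bb‖ ≤ θ₃ * ‖A'‖ ^ 2) :
    QuadAnalytic (W80 ρ τ U₀ H C εC (Jcur (L := L) (η := η) (lev₀ := lev₀) U₀) Δπ)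
        (C4W ‖ρ‖ ‖τ‖ (C₁ * B₃ * ε₁) ‖Δπ‖ b C₂ (1 / (1 - 4 * b * C₂ * (εC + aC))) θ₃ θE CV R') R' ∧
      AnalyticOnNhd ℂ (W80 ρ τ U₀ H C εC (Jcur (L := L) (η := η) (lev₀ := lev₀) U₀) Δπ) {Y : Space115 L η lev₀ lev₁ Dc | ‖Y‖ < R'} := by
  obtain ⟨hq, han⟩ := quadAnalytic_W80 ρ τ U₀ hCV hqV RC hC (Jcur (L := L) (η := η) (lev₀ := lev₀) U₀) Δπ hθ₃ hθE hR'0 hR'a hR'V hΘE hΘ3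
  have hmono := C4W_mono_J (nΔ := ‖Δπ‖) (b := b) (C₂ := C₂) (ℓ := 1 / (1 - 4 * b * C₂ * (εC + aC))) (θE := θE) (CV := CV)
    (R' := R') (norm_nonneg ρ) (norm_nonneg τ) hθ₃ (norm_Jcur_le (L := L) (η := η) (lev₀ := lev₀) U₀ hU hK h14)
  exact ⟨⟨fun Y hY => (hq.quad Y hY).trans (mul_le_mul_of_nonneg_right hmono (sq_nonneg _)), hq.lineAnalytic⟩, han⟩

end Prop4

end Literature.MathematicalPhysics.QuantumFieldTheory.Balaban1983to89.B11Eq98CurrentSlot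

end
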